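import Mathlib
import HarnessLib
import HarnessLib.Audit
import Summits.AtomisticToContinuum.Statement
import Literature.MathematicalPhysics.QuantumManyBody.PeriodicBoseGas

/-!
Route: BECJastrowKac

CLOSED (retired) 2026-08-15T13:39:02Z by operator:999:1257524 — reason: not-a-thesis: assembly does not conclude the sub-problem Statement — note: D-0027 §2.1 audit (human 2026-08-15: routes that do not decide the summit are removed): the assembly concludes `Literature.MathematicalPhysics.QuantumManyBody.BoseGas.BoseEinsteinCondensation`, not the sub-problem statement; a NEW conforming route may be opened from the same idea (generated `closes . The file is kept as the record of this route; refuted decls are indexed as negative knowledge (`ledger negatives`).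

# Route BECJastrowKac — The dilute Bose gas as an exactly dressed Kac model — window splitting, then
Kac-window condensation on the torus

It suffices to show X_JK := SplittingConstruction ∧ DressedKacCondensation (card
jastrow-parent-kac-splitting, items J0 and J3 made
formal), on the TORUS. SplittingConstruction: every repulsive finite-range v admits, at every large
radius R, an EXACT Jastrow–Kac
splitting — a radial profile 0 ≤ f ≤ 1, f = 1 beyond R, that minimises ∫2|∇φ|² + (v − w)φ² among φ =
1 off B_R with minimum value 0
(⇔ the weak pair equation −2Δf + (v − w)f = 0 AND f′(R) = 0 ⇔ v − w has scattering length ZERO),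
where the Kac part w ≥ 0 is bounded
by A/R³, of range R, ∫w ≤ A (A ≈ 16πa), and ∫(1 − f²) ≤ A R². DressedKacCondensation: universal
thresholds M, η, ε₀ exist such that for
every (v, w, f, R) so related and every density in the window ρR³ ≥ M (Kac number), ρR²∫w ≤ η
(sub-healing), w ≤ η/R² (Born),
ρ∫(1 − f²) ≤ ε₀ (Mayer), near-minimisers of the ORIGINAL periodic energy of v on the torus of side
(N/ρ)^{1/3} have constant-mode
occupation ≥ cN for all large N. Choosing R = (M/ρ)^{1/3} puts every v in the window for ρ < ρ₀(v),
so X_JK ⇒ PeriodicBEC(v)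
(target, shared with route BECPeriodicReduction) ⇒ the conjunct via BoundaryTransferWeak (shared
crux). KacWindowCondensation, the
f ≡ 1 / v = w instance of DressedKacCondensation (the weakly coupled Kac gas itself), is ranked
first: it is where the mechanism —
Kac–Siegert auxiliary field + CLT for collective density modes with parameter (ρR³)^{-1/2} — must
work before any dressing.
Lean (typable waypoint implied by X_JK; the two X-decls are items of this file): `∀ v : ℝ → ENNReal,
Literature.MathematicalPhysics.QuantumManyBody.BoseGas.IsRepulsiveFiniteRange v → ∃ ρ₀ : ℝ, 0 < ρ₀ ∧
∀ ρ : ℝ, 0 < ρ → ρ < ρ₀ → ∃ c : ℝ, 0 < c ∧ ∀ᶠ N : ℕ in Filter.atTop, ∃ δ : ENNReal, 0 < δ ∧ ∀ Ψ :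
Literature.MathematicalPhysics.QuantumManyBody.BoseGas.PeriodicTrialState N
(Literature.MathematicalPhysics.QuantumManyBody.BoseGas.sideLength ρ N),
Literature.MathematicalPhysics.QuantumManyBody.BoseGas.periodicEnergy v Ψ ≤
Literature.MathematicalPhysics.QuantumManyBody.BoseGas.periodicGroundStateEnergy v N
(Literature.MathematicalPhysics.QuantumManyBody.BoseGas.sideLength ρ N) + δ → ENNReal.ofReal (c * N)
≤ Literature.MathematicalPhysics.QuantumManyBody.BoseGas.condensateOccupation N
(Literature.MathematicalPhysics.QuantumManyBody.BoseGas.sideLength ρ N) Ψ.ψ`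

## Assembly
Given v admissible: SplittingConstruction gives A, R₁; DressedKacCondensation gives universal M, η,
ε₀. Put R(ρ) := (M/ρ)^{1/3} and
ρ₀ := min{ M·max(R₁, A/η, 1)^{-3}, (min(η, ε₀)/((A+1)M^{2/3}))³ }. For 0 < ρ < ρ₀: ρR³ = M; R ≥
max(R₁, A/η) so w ≤ A/R³ ≤ η/R²;
ofReal(ρR²)·∫w ≤ ofReal(ρR²A) = ofReal(A M^{2/3} ρ^{1/3}) ≤ ofReal η; ofReal ρ · defect ≤
ofReal(ρAR²) ≤ ofReal ε₀. Hence the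
BEC-body for (v, ρ); this is the hypothesis of BoundaryTransferWeak at v, whose conclusion is the
conjunct's body. Pure real
arithmetic (rpow) + instantiation; KacWindowCondensation is listed first but is not needed logically
(it is the f ≡ 1 instance of
DressedKacCondensation: v := w, f := 1, 2·scatteringFunctional w 1 = ∫w, defect 0).

Rationale: WHY THIS LINE. The Jastrow-parent identity H = H_J + Σ_{i<j} w(x_i − x_j) − W₃ (H_J ≥ 0, H_J Ψ_J =
0, Ψ_J = Π f(x_i − x_j)) is exact, and with the
cutoff in the window ρ^{-1/3} ≪ R ≪ ξ = (8πρa)^{-1/2} it moves the whole scattering length, at Born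
level, into a weak smooth
repulsion of range R (∫w = 8πa(1 + O(a/R))) while the reference |Ψ_J|² is a Mayer-convergent
classical gas: the dilute gas (hard
cores included) becomes a cluster-convergent reversible diffusion plus a Kac two-body term with two
explicit small parameters,
1/(ρR³) and ρaR² (BastiCenatiempoSchlein doi:10.1017/fms.2021.66 and arXiv:2212.04431 use the
identity as an upper-bound device;
FournaisSolovej2020 / BrietzkeFournaisSolovej2020 dress by the scattering solution before
Bogoliubov). Imported areas: classical
Kac/van der Waals theory (LebowitzPenrose1966; quantum: Lieb 1966 doi:10.1063/1.1704992; finite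
range: Lebowitz–Mazel–Presutti
doi:10.1023/A:1004591218510, Kac–Siegert + expansion around mean field), cluster expansions in the
canonical ensemble
(PulvirentiTsagkarogiannis2012), Jastrow ODLRO (Reatto1969). What it does that prior routes do not:
BECRenormGroup flows the bare
coherent-state action; BECInfraredBound/BECPinning state targets; here one identity produces an
explicit reference plus a MEAN-FIELD
perturbation, and the first crux isolates the pure weak Kac gas — the easiest genuinely interacting
3-D continuum Bose gas in which
thermodynamic-limit BEC is still open (Dereziński–Napiórkowski doi:10.1007/s00023-013-0302-4 §1:
"the ultimate goal would be … the
thermodynamic limit with a fixed coupling constant. Since this is at the moment out of reach …";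
their volumes obey L^{18} ≤ bN;
Seiringer2011 fixed volume; GS2009 doi:10.1007/s10955-009-9718-0 energy only; the BFKT programme
BalabanEtAl2010/BFKT2017 stops before
the symmetry-broken infrared regime). Negatives index: empty at filing.

RANKED CRUXES. #0 PeriodicBEC (target) — PeriodicBEC (verbatim stmt-AtomisticToContinuum-0826 of
route BECPeriodicReduction, shared): constant-mode BEC for δ-near-minimisers of the periodic energy
on the torus of side (N/ρ)^{1/3}, every repulsive finite-range v, all small ρ; implied by
SplittingConstruction ∧ DressedKacCondensation by the window arithmetic of the Assembly. (why it
might fail: the textbook open problem (LSSY2005 §1.2/Ch.5); here it is only the waypoint — it fails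
for this route iff DressedKacCondensation or SplittingConstruction fails.)
[LiebSeiringerSolovejYngvason2005, Fournais2020, Junge2026]
#2 KacWindowCondensation (crux) — Pure Kac-window condensation (card J3 with f ≡ 1): there are
universal M, η > 0 such that for every measurable radial w : ℝ → [0,∞] with w ≤ η/R² on [0,R], w = 0
beyond R, and every density with ρR³ ≥ M and ρR²∫_{ℝ³} w ≤ η, δ-near-minimisers of the periodic
N-body energy of w on the torus of side (N/ρ)^{1/3} have constant-mode occupation ≥ cN for all large
N (c, the N-threshold and δ may depend on everything). Scale-covariant; the f ≡ 1, v = w instance of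
DressedKacCondensation; physically the weakly depleted Bogoliubov fluid (depletion ≲ η^{3/2}/M).
[difficulty: open-problem] (why it might fail: Uniformity in L=(N/ρ)^{1/3}→∞ at fixed (w,R,ρ):
printed Bogoliubov control needs L^18≲N (DN2014) or fixed L; if the order parameter needs the
longitudinal/large-field sector beyond the healing length, mean field + CLT in (ρR³)^{-1/2} cannot
be uniform in L (Benfatto1994; BFKT2017).) [doi:10.1007/s00023-013-0302-4, Seiringer2011,
doi:10.1007/s10955-009-9718-0, doi:10.1063/1.1704992, Benfatto1994, BFKT2017, BalabanEtAl2010,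
Literature.Barriers.AtomisticToContinuum.BogoliubovPerturbationInfraredNarrow]
#3 DressedKacCondensation (crux) — Dressed Kac-window condensation (card J3, general f): universal
M, η, ε₀ > 0 such that for all measurable v, w : ℝ → [0,∞] of range ≤ R with w ≤ η/R², all profiles
f (0 ≤ f ≤ 1, f = 1 on [R,∞), x ↦ f|x| Lipschitz off every ball around 0) satisfying the EXACT
splitting relations — value identity ∫(2|∇f|² + v f²) = ∫ w f² and minimality ∫(2|∇f|²+vf²) + ∫wφ² ≤
∫(2|∇φ|²+vφ²) + ∫wf² for every C¹ φ equal to 1 off B_R (i.e. f is the zero-scattering-length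
solution of v − w, f′(R)=0; hard cores v = ⊤ allowed, f then vanishes on the core) — and every ρ > 0
in the window ρR³ ≥ M, ρR²∫w ≤ η, ρ∫(1−f²) ≤ ε₀: δ-near-minimisers of the periodic energy OF v on
the torus of side (N/ρ)^{1/3} have constant-mode occupation ≥ cN for all large N. Proof line of the
card: Ψ = (Π f)·g, exact identity ⟨Ψ,HΨ⟩ = ∫F²|∇g|² + ∫|Ψ|²(Σ w^per − W₃), reference ODLRO by Πφ_j ≥
1−Σ(1−φ_j), Kac–Siegert on Σw, CLT at scale R, W₃ of relative size ρ∫(1−f²). [deps: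
KacWindowCondensation] [difficulty: open-problem] (why it might fail: Universal thresholds may not
exist (cluster/CLT constants could depend on the shapes of w, f beyond sup, ∫w, defect); the
attractive −W₃ and the cores must be dominated INSIDE the F² measure uniformly in L (large-field
problem); for v with gapped ⊤-sets trapped components must be discarded first.)
[doi:10.1017/fms.2021.66, arXiv:2212.04431, Reatto1969, PulvirentiTsagkarogiannis2012,
doi:10.1023/A:1004591218510, FournaisSolovej2020, BrietzkeFournaisSolovej2020,
LiebSeiringerSolovejYngvason2005]
#4 SplittingConstruction (crux) — Existence of the window splitting (card J0, exact): for every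
repulsive finite-range v there are A ≥ 0 and R₁ > 0 such that for every R ≥ R₁ there exist a
measurable Kac part w (0 ≤ w ≤ A/R³, w = 0 beyond R, ∫_{ℝ³} w ≤ A) and a profile f (0 ≤ f ≤ 1, f = 1
on [R,∞), punctured-Lipschitz, ∫(1−f²) ≤ A R²) satisfying the two splitting relations of
DressedKacCondensation with v (v = 0 beyond R). Construction: f = exact scattering minimiser of v on
[0,R/2] (LSSY App. C; hard cores and r^{-3/2}-type singular v included, whence only local Lipschitz
off 0), bent by f′ = (ca/r²)χ, χ ↓ from 1 to 0 on [R/2,R], so Δf = caχ′/r² ≤ 0, w := −2Δf/f ∈ [0,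
32a/R³], ∫w = 8πca(1+O(a/R)), f′(R)=0; minimality from convexity since sup w·R² ≪ 2π² (Dirichlet gap
of B_R); a = 0 ⇒ v = 0 a.e. (LSSY2005_zeroScatteringLength, proved) ⇒ w = 0, f = 1, A = 0.
[difficulty: L] (why it might fail: Exactness is load-bearing: needs the EXACT minimiser with
f′(R)=0 and 0≤w≤A/R³ for every measurable v≥0 incl. hard cores and singular finite v (f not C¹, not
Lipschitz at 0); an ε-approximate C¹ profile (LSSY2005_dysonProfile) does not give the identity; a
wrong regularity clause makes it false.) [LiebSeiringerSolovejYngvason2005, Fournais2020,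
Literature.MathematicalPhysics.QuantumManyBody.BoseGas.LSSY2005_dysonProfile,
Literature.MathematicalPhysics.QuantumManyBody.BoseGas.LSSY2005_scatteringSolution,
doi:10.1017/fms.2021.66]
#5 BoundaryTransferWeak (crux) — BoundaryTransferWeak (verbatim stmt-AtomisticToContinuum-0827 of
route BECPeriodicReduction, shared): for each repulsive finite-range v, PeriodicBEC-body(v) ⇒ ∃ρ₀
∀ρ∈(0,ρ₀) HasGroundStateBEC v ρ (Dirichlet, mode-free). Not glue (near-minimiser slacks O(N/L²) vs
wall energy ≫ N/L²); expected via Neumann bracketing of interior sub-boxes + λ_max ≥ tr γ²/N.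
[difficulty: L] (why it might fail: PeriodicBEC(v) is ground-state-only (δ after N); the Dirichlet
ground state restricted to interior boxes is neither periodic nor of sharp N, so the hypothesis may
never fire (transfer ≈ conjunct); BEC can be BC-sensitive (Robinson 1976).)
[LiebSeiringerSolovejYngvason2005, Basti2022, BoccatoSeiringer2023, Junge2026,
doi:10.1007/bf01608554]

TWO-LAYER PLAN. Foreseen, not filed: KacWindowCondensation ⇐ K1 → K2 → KacWindowCondensation with K1
= a T=0 Kac–Siegert/Gaussian-domination
infrared bound for torus near-minimisers of the Kac gas, n_p ≤ C(√(ρ∫w)/|p| + (ρ ŵ(p))²/p⁴)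
uniformly in L, and K2 = Parseval sum
rule on the torus (the BECInfraredBound crux-3 pattern, periodic). DressedKacCondensation ⇐ D1 → D2
→ D with D1 = reference
bounds for F² = Πf² (landscape flatness ∫Π_j f(x−y_j)dx ≥ L³(1 − ρ∫(1−f)), two-point insertion ≥ c,
CLT for density modes at
scale R; cluster expansion, provable) and D2 = the dressed infrared bound relative to F² (W₃ and
cores dominated in the measure).
The N-body identity periodicEnergy v (F·g) = ∫F²|∇g|² + ∫|Fg|²(Σw^per − W₃) and E₀^per < ⊤ in the
window ride as --supports lemmas.

KILL CRITERIA. ¬KacWindowCondensation (a weakly coupled Kac gas in the window whose torus ground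
states decondense as N → ∞) closes the route
outright (close --reason refuted:KacWindowCondensation) — and would be a discovery.
¬DressedKacCondensation with KacWindowCondensation
standing ⇒ the dressing (cores/W₃ inside F²) is the obstruction: pivot to the parent-Hamiltonian
deformation line (card
parent-hamiltonian-anchor) or restate with W₃-free reference; ¬SplittingConstruction as stated ⇒
restate the regularity clause (not a
kill: the analysis is LSSY App. C). ¬BoundaryTransferWeak kills the Dirichlet transfer for every
torus route (shared fate with
BECPeriodicReduction) ⇒ pivot to a Dirichlet-direct dressed statement with a wall factor.
PeriodicBEC proved elsewhere moots ranks 2–4.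

NOT DECOMPOSED YET. The Kac–Siegert / collective-field representation as a Lean object (no
functional integral in the library; the cruxes are stated
over the variational API only); the N-body splitting identity and the three-body bound (card J2:
−Σ_i|Σ_j∇u_ij|² ≤ −W₃ ≤ Σ_{i≠j}|∇u|²)
as items — they are lemmas inside DressedKacCondensation (--supports); reference ODLRO of the
Jastrow state (elementary:
Πφ_j ≥ 1 − Σ(1−φ_j) gives n₀/N ≥ (1 − ρ∫(1−f))², the LSSY (2.22)–(2.26) elimination); finiteness of
E₀^per in the window; the glue
DressedKacCondensation → KacWindowCondensation; constants (M, η, ε₀ are existential). No regime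
split at open.

CHEAPEST FALSIFIER. (i) Lean, minutes: DressedKacCondensation → KacWindowCondensation must be
provable by instantiation (v := w, f := 1: 2·scatteringFunctional w 1
= ∫w, ∫(1 − 1²) = 0, minimality from ∫2|∇φ|² ≥ 0) — if the hypotheses of the dressed crux cannot be
met by f ≡ 1 the interface
is mis-typed. (ii) Junk audit: E₀^per = ⊤ would falsify both condensation cruxes (w bounded ⇒
finite; dressed: product state with
(N−1)·defect < L³, i.e. ε₀ < 1). (iii) Physics, one page: Bogoliubov depletion of the Kac gas in the
window is ≲ (ρ a_w³)^{1/2} ≤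
C η^{3/2}/M with a_w = ∫w/8π and no roton softening (ρ|ŵ(k)| ≤ η/R² ≪ k² at k ≳ 1/R) — a refuter
finding an instability inside the
window kills rank 2. (iv) Lookup when OpenAlex/arXiv are back (HTTP 429 this session): any printed
thermodynamic-limit BEC theorem for
soft potentials at high density would turn rank 2 into a known fact (DN2014 §1 and Rougerie's EMS
survey say none exists).

NUMBERS. Window: R = a(ρa³)^{-s}, 1/3 < s < 1/2 (card): ρR³ = (ρa³)^{1−3s} → ∞, ρaR² = (ρa³)^{1−2s}
→ 0, ξ = (8πρa)^{-1/2}; Assembly uses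
R = (M/ρ)^{1/3}. Kac part: w ≤ 32a/R³ for the linear bend on [R/2,R] (R ≥ 4a), ∫w = 8πca(1+O(a/R)),
A := 16πa+… . Depletion
(Bogoliubov/LHY): 1 − n₀/N ≈ (8/(3√π))(ρa³)^{1/2} (LiebSeiringerSolovejYngvason2005 Ch. 2). Known
condensation scales: Fournais2020
Thm 1.2 L = C(ρa³)^{-δ}(ρa)^{-1/2} (PROVED in tree: Fournais2020_condensation_holds); Junge2026 Cor.
6 a(ρa³)^{-3/4-η};
DN2014 mean-field infinite volume L^{4d+6} ≤ bN^{1−α} (d = 3: L ≲ N^{1/18}).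

DEFINITION REQUESTS. None at open (the splitting interface is inlined variationally over
scatteringFunctional / IsScatteringTrial of PeriodicBoseGas.lean, so every signature elaborates
standalone with `import Mathlib` + PeriodicBoseGas, no opens — checked in ProbeSig.lean). Later,
once
SplittingConstruction lands: a structure `JastrowKacSplitting v R` (topic
Summits/AtomisticToContinuum/BoseEinsteinCondensation/Theorems)
bundling (w, f) and the two relations, to shorten DressedKacCondensation and its children.

Novelty: Searches (2026-08-15): lit search local/hybrid — searchd connection reset (rc error) all session;
lit search --source openalex: HTTP
429 (budget exhausted); --source arxiv: HTTP 429; --source crossref x5 ("excitation spectrum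
interacting bosons mean-field
infinite-volume limit" → doi:10.1007/s00023-013-0302-4; "ground state energy weakly interacting Bose
gas high density" →
doi:10.1007/s10955-009-9718-0; "quantum mechanical extension Lebowitz-Penrose van der Waals" →
doi:10.1063/1.1704992,
doi:10.1063/1.1704821; "Kac potential quantum Bose gas condensation", "Suto soft interaction
mean-field scaling" → nothing
closer); lit galaxy search --star all "Bose-Einstein condensation Kac potential" (0), "weakly
interacting Bose gas high density
condensation thermodynamic limit" (0), "Bose gas with Kac" (0); --star pdf "mean-field
infinite-volume limit" (1: Rougerie EMS survey),
"weakly interacting Bose gas at high density" (5: Carlen–Jauslin–Lieb simple equation, Yin free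
energy, Rougerie); lit read
arXiv:1305.3641 pp. 3–5 (quoted). Card-level audits (refuter audit-1/audit-14) already located
doi:10.1017/fms.2021.66,
arXiv:2212.04431, doi:10.1016/0375-9474(79)90212-4, FournaisSolovej2020,
BrietzkeFournaisSolovej2020, doi:10.1007/s10955-009-9718-0.
Nearest prior art found: doi:10.1007/s00023-013-0302-4 (Dereziński–Napiórkowski 2014: Bogoliubov
excitation spectrum for
H = −Δ + (L³/N)Σv in volumes L^{18} ≲ N, TL at fixed coupling declared out of reach — the regime
adjacent to rank 2, ene  [refs: 10.1007/s00023-013-0302-4, 10.1007/s10955-009-9718-0, 10.1063/1.1704992, 10.1063/1.1704821, 10.1017/fms.2021.66, 10.1016/0375-9474(79, 10.1007/s10955-009-9718-0., 10.1023/A:1004591218510, 1305.3641, 2212.04431, doi:10.1007/s00023-013-0302-4, doi:10.1007/s10955-009-9718-0, doi:10.1063/1.1704992, doi:10.1063/1.1704821, doi:10.1017/fms.2021.66, doi:10.1016/0375-9474, doi:10.1007/s10955-009-9718-0., d]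

Barriers (technique_class: Jastrow-parent, Kac-potential, Kac-Siegert, cluster-expansion): - technique_class: Jastrow-parent, Kac-potential, Kac-Siegert, cluster-expansion
- Literature.Barriers.AtomisticToContinuum.BogoliubovPerturbationInfrared: applies to ranks 2–3
beyond the healing length if they are attacked by finite-order expansion in the particle
representation; the line does not do that — after Kac–Siegert the expansion variable is the
collective density/phase field (hydrodynamic representation), the order parameter costs ONE
Goldstone propagator, and the small parameter (ρR³)^{-1/2} multiplies cubic collective vertices
carrying derivatives; honest residue: uniform-in-L control of the non-Gaussian remainder is a
large-field problem (why-might-fail of rank 2).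
- Literature.Barriers.AtomisticToContinuum.BogoliubovPerturbationInfraredNarrow: its conjuncts
(3)–(4) are exactly the bet — one phase propagator G_c is integrable on balls iff d ≥ 2, so ODLRO
(⟨θθ⟩ ∝ G_c) is infrared-finite in d = 3 while the blocked objects are Σ₁₂ and frequency-resolved
anomalous correlators below p_G, which ranks 2–3 never compute; conjunct (1) (the G_c² bubble) is
met only by vertex pairs, which in the collective representation carry s = 2 derivatives (conjunct
(2): finite in d = 3).
- Literature.Barriers.AtomisticToContinuum.KineticGapLengthScales: evaded by statement design — both
condensation cruxes are thermodynamic-limit claims at fixed ρ with δ after N, and the proposed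
proofs use the reference measure's ODLRO (an L-uniform cluster fact) and a mean-field parameter,
never L²

History (route lifecycle, newest last):
- 2026-08-15T13:39:02Z · CLOSED retired — not-a-thesis: assembly does not conclude the sub-problem Statement (operator:999:1257524)

sub-problem: BoseEinsteinCondensation · status: closed(retired) · opened planner-plancard-AtomisticToContinuum-BoseEin-6f592076-0 2026-08-15T11:24:47Z · rev 0 · ledger route-AtomisticToContinuum-BECJastrowKac
GENERATED by the gate from the ledger (D-0016/17). Provers cite these decls: `theorem foo : Summit.AtomisticToContinuum.BoseEinsteinCondensation.Theses.BECJastrowKac.<Decl> := …` in Summits/AtomisticToContinuum/BoseEinsteinCondensation/Theorems/<Name>.lean.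
-/

namespace Summit.AtomisticToContinuum.BoseEinsteinCondensation.Theses.BECJastrowKac

open scoped BigOperators Topology Manifold Classical MeasureTheory ProbabilityTheory Matrix InnerProductSpace ComplexConjugate ContinuousMap
open Filter Set Function TopologicalSpace MeasureTheory

attribute [summit_statement] _root_.BoseEinsteinCondensation

/-- item stmt-AtomisticToContinuum-0826 · target · rank 0 · closed · moot by None · by planner
why it might fail: the textbook open problem (LSSY2005 §1.2/Ch.5); here it is only the waypoint — it fails for this route iff DressedKacCondensation or SplittingConstruction fails.
sources: LiebSeiringerSolovejYngvason2005, Fournais2020, Junge2026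
[crux] PeriodicBEC: for every repulsive finite-range radial v there is ρ₀>0 such that for 0<ρ<ρ₀
there is c>0 with: for all large N there is δ>0 such that every PERIODIC trial state Ψ on the torus
of side L=(N/ρ)^{1/3} with periodicEnergy ≤ E₀^per(N,L)+δ has constant-mode occupation ⟨Ψ,n₀Ψ⟩ =
condensateOccupation N L Ψ ≥ cN. The open problem in the literature's own (translation-invariant)
setting; Fournais2020 Thm 1.2 gives it on scales L ≤ C(ρa³)^{-δ}(ρa)^{-1/2}, Junge2026 Cor. 6
(Neumann) up to a(ρa³)^{-3/4-η}. Sources: LiebSeiringerSolovejYngvason2005 Ch. 5; Fournais2020;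
Junge2026; ChongLiangNam2026. -/
@[route_item "route-AtomisticToContinuum-BECJastrowKac"]
def PeriodicBEC : Prop :=
  ∀ v : ℝ → ENNReal, Literature.MathematicalPhysics.QuantumManyBody.BoseGas.IsRepulsiveFiniteRange v → ∃ ρ₀ : ℝ, 0 < ρ₀ ∧ ∀ ρ : ℝ, 0 < ρ → ρ < ρ₀ → ∃ c : ℝ, 0 < c ∧ ∀ᶠ N : ℕ in Filter.atTop, ∃ δ : ENNReal, 0 < δ ∧ ∀ Ψ : Literature.MathematicalPhysics.QuantumManyBody.BoseGas.PeriodicTrialState N (Literature.MathematicalPhysics.QuantumManyBody.BoseGas.sideLength ρ N), Literature.MathematicalPhysics.QuantumManyBody.BoseGas.periodicEnergy v Ψ ≤ Literature.MathematicalPhysics.QuantumManyBody.BoseGas.periodicGroundStateEnergy v N (Literature.MathematicalPhysics.QuantumManyBody.BoseGas.sideLength ρ N) + δ → ENNReal.ofReal (c * N) ≤ Literature.MathematicalPhysics.QuantumManyBody.BoseGas.condensateOccupation N (Literature.MathematicalPhysics.QuantumManyBody.BoseGas.sideLength ρ N) Ψ.ψ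

/-- item stmt-AtomisticToContinuum-3822 · crux · rank 2 · closed · moot by None · by planner
why it might fail: Uniformity in L=(N/ρ)^{1/3}→∞ at fixed (w,R,ρ): printed Bogoliubov control needs L^18≲N (DN2014) or fixed L; if the order parameter needs the longitudinal/large-field sector beyond the healing length, mean field + CLT in (ρR³)^{-1/2} cannot be uniform in L (Benfatto1994; BFKT2017).
sources: doi:10.1007/s00023-013-0302-4, Seiringer2011, doi:10.1007/s10955-009-9718-0, doi:10.1063/1.1704992, Benfatto1994, BFKT2017
[crux] Pure Kac-window condensation (card J3 with f ≡ 1): there are universal M, η > 0 such that for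
every measurable radial w : ℝ → [0,∞] with w ≤ η/R² on [0,R], w = 0 beyond R, and every density with
ρR³ ≥ M and ρR²∫_{ℝ³} w ≤ η, δ-near-minimisers of the periodic N-body energy of w on the torus of
side (N/ρ)^{1/3} have constant-mode occupation ≥ cN for all large N (c, the N-threshold and δ may
depend on everything). Scale-covariant; the f ≡ 1, v = w instance of DressedKacCondensation;
physically the weakly depleted Bogoliubov fluid (depletion ≲ η^{3/2}/M). [difficulty: open-problem] -/
@[route_item "route-AtomisticToContinuum-BECJastrowKac"]
def KacWindowCondensation : Prop :=
  open Literature.MathematicalPhysics.QuantumManyBody.BoseGas in ∃ M η : ℝ, 0 < M ∧ 0 < η ∧ ∀ (w : ℝ → ENNReal) (R ρ : ℝ), Measurable w → 0 < R → 0 < ρ → (∀ s, w s ≤ ENNReal.ofReal (η / R ^ 2)) → (∀ s, R < s → w s = 0) → M ≤ ρ * R ^ 3 → ENNReal.ofReal (ρ * R ^ 2) * (∫⁻ x : Space, w ‖x‖) ≤ ENNReal.ofReal η → ∃ c : ℝ, 0 < c ∧ ∀ᶠ N : ℕ in Filter.atTop, ∃ δ : ENNReal, 0 < δ ∧ ∀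 Ψ : PeriodicTrialState N (sideLength ρ N), periodicEnergy w Ψ ≤ periodicGroundStateEnergy w N (sideLength ρ N) + δ → ENNReal.ofReal (c * N) ≤ condensateOccupation N (sideLength ρ N) Ψ.ψ

/-- item stmt-AtomisticToContinuum-3823 · crux · rank 3 · closed · moot by None · by planner
why it might fail: Universal thresholds may not exist (cluster/CLT constants could depend on the shapes of w, f beyond sup, ∫w, defect); the attractive −W₃ and the cores must be dominated INSIDE the F² measure uniformly in L (large-field problem); for v with gapped ⊤-sets trapped components must be discarded first.
sources: doi:10.1017/fms.2021.66, arXiv:2212.04431, Reatto1969, PulvirentiTsagkarogiannis2012, doi:10.1023/A:1004591218510, FournaisSolovej2020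
[crux] Dressed Kac-window condensation (card J3, general f): universal M, η, ε₀ > 0 such that for
all measurable v, w : ℝ → [0,∞] of range ≤ R with w ≤ η/R², all profiles f (0 ≤ f ≤ 1, f = 1 on
[R,∞), x ↦ f|x| Lipschitz off every ball around 0) satisfying the EXACT splitting relations — value
identity ∫(2|∇f|² + v f²) = ∫ w f² and minimality ∫(2|∇f|²+vf²) + ∫wφ² ≤ ∫(2|∇φ|²+vφ²) + ∫wf² for
every C¹ φ equal to 1 off B_R (i.e. f is the zero-scattering-length solution of v − w, f′(R)=0; hard
cores v = ⊤ allowed, f then vanishes on the core) — and every ρ > 0 in the window ρR³ ≥ M, ρR²∫w ≤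
η, ρ∫(1−f²) ≤ ε₀: δ-near-minimisers of the periodic energy OF v on the torus of side (N/ρ)^{1/3}
have constant-mode occupation ≥ cN for all large N. Proof line of the card: Ψ = (Π f)·g, exact
identity ⟨Ψ,HΨ⟩ = ∫F²|∇g|² + ∫|Ψ|²(Σ w^per − W₃), reference ODLRO by Πφ_j ≥ 1−Σ(1−φ_j), Kac–Siegert
on Σw, CLT at scale R, W₃ of relative size ρ∫(1−f²). [deps: KacWindowCondensation] [difficulty:
open-problem] -/
@[route_item "route-AtomisticToContinuum-BECJastrowKac"]
def DressedKacCondensation : Prop :=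
  open Literature.MathematicalPhysics.QuantumManyBody.BoseGas in ∃ M η ε₀ : ℝ, 0 < M ∧ 0 < η ∧ 0 < ε₀ ∧ ∀ (v w : ℝ → ENNReal) (f : ℝ → ℝ) (R ρ : ℝ), Measurable v → Measurable w → 0 < R → 0 < ρ → (∀ s, R < s → v s = 0) → (∀ s, R < s → w s = 0) → (∀ s, w s ≤ ENNReal.ofReal (η / R ^ 2)) → (∀ s, 0 ≤ f s ∧ f s ≤ 1) → (∀ s, R ≤ s → f s = 1) → (∀ ε : ℝ, 0 < ε → ∃ K : NNReal, LipschitzOnWith K (fun x : Space => f ‖x‖) {x : Space | ε ≤ ‖x‖}) → 2 * scatteringFunctional v (fun x : Space => f ‖x‖) = ∫⁻ x : Space, w ‖x‖ * ENNReal.ofReal (f ‖x‖ ^ 2) → (∀ φ : Space → ℝ, IsScatteringTrial φ → (∀ x : Space, R ≤ ‖x‖ → φ x = 1) → 2 * scatteringFunctional v (fun x : Space => f ‖x‖) + ∫⁻ x : Space, w ‖x‖ * ENNReal.ofReal (φ x ^ 2) ≤ 2 * scatteringFunctional v φ + ∫⁻ x : Space, w ‖x‖ * ENNReal.ofReal (f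 ‖x‖ ^ 2)) → M ≤ ρ * R ^ 3 → ENNReal.ofReal (ρ * R ^ 2) * (∫⁻ x : Space, w ‖x‖) ≤ ENNReal.ofReal η → ENNReal.ofReal ρ * (∫⁻ x : Space, ENNReal.ofReal (1 - f ‖x‖ ^ 2)) ≤ ENNReal.ofReal ε₀ → ∃ c : ℝ, 0 < c ∧ ∀ᶠ N : ℕ in Filter.atTop, ∃ δ : ENNReal, 0 < δ ∧ ∀ Ψ : PeriodicTrialState N (sideLength ρ N), periodicEnergy v Ψ ≤ periodicGroundStateEnergy v N (sideLength ρ N) + δ → ENNReal.ofReal (c * N) ≤ condensateOccupation N (sideLength ρ N) Ψ.ψ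

/-- item stmt-AtomisticToContinuum-3824 · crux · rank 4 · closed · moot by None · by planner
why it might fail: Exactness is load-bearing: needs the EXACT minimiser with f′(R)=0 and 0≤w≤A/R³ for every measurable v≥0 incl. hard cores and singular finite v (f not C¹, not Lipschitz at 0); an ε-approximate C¹ profile (LSSY2005_dysonProfile) does not give the identity; a wrong regularity clause makes it false.
sources: LiebSeiringerSolovejYngvason2005, Fournais2020, Literature.MathematicalPhysics.QuantumManyBody.BoseGas.LSSY2005_dysonProfile, Literature.MathematicalPhysics.QuantumManyBody.BoseGas.LSSY2005_scatteringSolution, doi:10.1017/fms.2021.66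
[crux] Existence of the window splitting (card J0, exact): for every repulsive finite-range v there
are A ≥ 0 and R₁ > 0 such that for every R ≥ R₁ there exist a measurable Kac part w (0 ≤ w ≤ A/R³, w
= 0 beyond R, ∫_{ℝ³} w ≤ A) and a profile f (0 ≤ f ≤ 1, f = 1 on [R,∞), punctured-Lipschitz, ∫(1−f²)
≤ A R²) satisfying the two splitting relations of DressedKacCondensation with v (v = 0 beyond R).
Construction: f = exact scattering minimiser of v on [0,R/2] (LSSY App. C; hard cores and
r^{-3/2}-type singular v included, whence only local Lipschitz off 0), bent by f′ = (ca/r²)χ, χ ↓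
from 1 to 0 on [R/2,R], so Δf = caχ′/r² ≤ 0, w := −2Δf/f ∈ [0, 32a/R³], ∫w = 8πca(1+O(a/R)),
f′(R)=0; minimality from convexity since sup w·R² ≪ 2π² (Dirichlet gap of B_R); a = 0 ⇒ v = 0 a.e.
(LSSY2005_zeroScatteringLength, proved) ⇒ w = 0, f = 1, A = 0. [difficulty: L] -/
@[route_item "route-AtomisticToContinuum-BECJastrowKac"]
def SplittingConstruction : Prop :=
  open Literature.MathematicalPhysics.QuantumManyBody.BoseGas in ∀ v : ℝ → ENNReal, IsRepulsiveFiniteRange v → ∃ A R₁ : ℝ, 0 ≤ A ∧ 0 < R₁ ∧ ∀ R : ℝ, R₁ ≤ R → ∃ (w : ℝ → ENNReal) (f : ℝ → ℝ), Measurable w ∧ (∀ s, R < s → v s = 0) ∧ (∀ s, R < s → w s = 0) ∧ (∀ s, w s ≤ ENNReal.ofReal (A / R ^ 3)) ∧ (∫⁻ x : Space, w ‖x‖) ≤ ENNReal.ofReal A ∧ (∀ s, 0 ≤ f s ∧ f s ≤ 1) ∧ (∀ s, R ≤ s → f s = 1) ∧ (∀ ε : ℝ, 0 < ε → ∃ K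 : NNReal, LipschitzOnWith K (fun x : Space => f ‖x‖) {x : Space | ε ≤ ‖x‖}) ∧ (∫⁻ x : Space, ENNReal.ofReal (1 - f ‖x‖ ^ 2)) ≤ ENNReal.ofReal (A * R ^ 2) ∧ 2 * scatteringFunctional v (fun x : Space => f ‖x‖) = ∫⁻ x : Space, w ‖x‖ * ENNReal.ofReal (f ‖x‖ ^ 2) ∧ (∀ φ : Space → ℝ, IsScatteringTrial φ → (∀ x : Space, R ≤ ‖x‖ → φ x = 1) → 2 * scatteringFunctional v (fun x : Space => f ‖x‖) + ∫⁻ x : Space, w ‖x‖ * ENNReal.ofReal (φ x ^ 2) ≤ 2 * scatteringFunctional v φ + ∫⁻ x : Space, w ‖x‖ * ENNReal.ofReal (f ‖x‖ ^ 2))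

/-- item stmt-AtomisticToContinuum-0827 · crux · rank 5 · open · by planner
why it might fail: PeriodicBEC(v) is ground-state-only (δ after N); the Dirichlet ground state restricted to interior boxes is neither periodic nor of sharp N, so the hypothesis may never fire (transfer ≈ conjunct); BEC can be BC-sensitive (Robinson 1976).
sources: LiebSeiringerSolovejYngvason2005, Basti2022, BoccatoSeiringer2023, Junge2026, doi:10.1007/bf01608554
[crux] BoundaryTransferWeak (mode-free boundary-condition transfer, per potential): for each
repulsive finite-range v, PeriodicBEC(v) implies ∃ρ₀>0 ∀ρ∈(0,ρ₀) HasGroundStateBEC v ρ (Dirichlet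
ground state, λ_max(γ) ≥ cN via condensateNumber). Not glue: near-minimiser slacks are O(N/L²) while
Dirichlet/periodic energies differ by a boundary term ≫ N/L², so no energy-comparison proof;
expected route: Neumann bracketing of interior sub-boxes (−Δ_Dir ≥ ⊕−Δ_Neu, v ≥ 0) + a mode-free
criterion (λ_max ≥ tr γ²/N). Only the ENERGY analogue is in print (LiebSeiringerSolovejYngvason2005
Ch. 2 after (2.8)). v ≡ 0: hypothesis and conclusion both true. -/
@[route_item "route-AtomisticToContinuum-BECJastrowKac"]
def BoundaryTransferWeak : Prop :=
  ∀ v : ℝ → ENNReal, Literature.MathematicalPhysics.QuantumManyBody.BoseGas.IsRepulsiveFiniteRange v → (∃ ρ₀ : ℝ, 0 < ρ₀ ∧ ∀ ρ : ℝ, 0 < ρ → ρ < ρ₀ → ∃ c : ℝ, 0 < c ∧ ∀ᶠ N : ℕ in Filter.atTop, ∃ δ : ENNReal, 0 < δ ∧ ∀ Ψ : Literature.MathematicalPhysics.QuantumManyBody.BoseGas.PeriodicTrialState N (Literature.MathematicalPhysics.QuantumManyBody.BoseGas.sideLength ρ N), Literature.MathematicalPhysics.QuantumManyBody.BoseGas.periodicEnergy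 v Ψ ≤ Literature.MathematicalPhysics.QuantumManyBody.BoseGas.periodicGroundStateEnergy v N (Literature.MathematicalPhysics.QuantumManyBody.BoseGas.sideLength ρ N) + δ → ENNReal.ofReal (c * N) ≤ Literature.MathematicalPhysics.QuantumManyBody.BoseGas.condensateOccupation N (Literature.MathematicalPhysics.QuantumManyBody.BoseGas.sideLength ρ N) Ψ.ψ) → ∃ ρ₀ : ℝ, 0 < ρ₀ ∧ ∀ ρ : ℝ, 0 < ρ → ρ < ρ₀ → Literature.MathematicalPhysics.QuantumManyBody.BoseGas.HasGroundStateBEC v ρ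

/-- item stmt-AtomisticToContinuum-3825 · assembly · rank 1 · closed · moot by None · by planner
sources: LiebSeiringerSolovejYngvason2005
[assembly] KacWindowCondensation → SplittingConstruction → DressedKacCondensation →
BoundaryTransferWeak → BoseEinsteinCondensation, with the four hypotheses INLINED verbatim (so the
signature elaborates standalone, as BECPeriodicReduction.Assembly); window arithmetic R =
(M/ρ)^{1/3}, then the shared transfer; skeleton `fun v hv => hT v hv (glue hS hD v hv)` checked in
Sketch.lean. -/
@[route_item "route-AtomisticToContinuum-BECJastrowKac"]
def Assembly : Prop :=
  (open Literature.MathematicalPhysics.QuantumManyBody.BoseGas in ∃ M η : ℝ, 0 < M ∧ 0 < η ∧ ∀ (w : ℝ → ENNReal) (R ρ : ℝ), Measurable w → 0 < R → 0 < ρ → (∀ s, w s ≤ ENNReal.ofReal (η / R ^ 2)) → (∀ s, R < s → w s = 0) → M ≤ ρ * R ^ 3 → ENNReal.ofReal (ρ * R ^ 2) * (∫⁻ x : Space, w ‖x‖) ≤ ENNReal.ofReal η → ∃ c : ℝ, 0 < c ∧ ∀ᶠ N : ℕ in Filter.atTop, ∃ δ : ENNReal, 0 < δ ∧ ∀ Ψ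 : PeriodicTrialState N (sideLength ρ N), periodicEnergy w Ψ ≤ periodicGroundStateEnergy w N (sideLength ρ N) + δ → ENNReal.ofReal (c * N) ≤ condensateOccupation N (sideLength ρ N) Ψ.ψ) → (open Literature.MathematicalPhysics.QuantumManyBody.BoseGas in ∀ v : ℝ → ENNReal, IsRepulsiveFiniteRange v → ∃ A R₁ : ℝ, 0 ≤ A ∧ 0 < R₁ ∧ ∀ R : ℝ, R₁ ≤ R → ∃ (w : ℝ → ENNReal) (f : ℝ → ℝ), Measurable w ∧ (∀ s, R < s → v s = 0) ∧ (∀ s, R < s → w s = 0) ∧ (∀ s, w s ≤ ENNReal.ofReal (A / R ^ 3)) ∧ (∫⁻ x : Space, w ‖x‖) ≤ ENNReal.ofReal A ∧ (∀ s, 0 ≤ f s ∧ f s ≤ 1) ∧ (∀ s, R ≤ s → f s = 1) ∧ (∀ ε : ℝ, 0 < ε → ∃ K : NNReal, LipschitzOnWith K (fun x : Space => f ‖x‖) {x : Space | ε ≤ ‖x‖}) ∧ (∫⁻ x : Space, ENNReal.ofReal (1 - f ‖x‖ ^ 2)) ≤ ENNReal.ofReal (A * R ^ 2) ∧ 2 *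 scatteringFunctional v (fun x : Space => f ‖x‖) = ∫⁻ x : Space, w ‖x‖ * ENNReal.ofReal (f ‖x‖ ^ 2) ∧ (∀ φ : Space → ℝ, IsScatteringTrial φ → (∀ x : Space, R ≤ ‖x‖ → φ x = 1) → 2 * scatteringFunctional v (fun x : Space => f ‖x‖) + ∫⁻ x : Space, w ‖x‖ * ENNReal.ofReal (φ x ^ 2) ≤ 2 * scatteringFunctional v φ + ∫⁻ x : Space, w ‖x‖ * ENNReal.ofReal (f ‖x‖ ^ 2))) → (open Literature.MathematicalPhysics.QuantumManyBody.BoseGas in ∃ M η ε₀ : ℝ, 0 < M ∧ 0 < η ∧ 0 < ε₀ ∧ ∀ (v w : ℝ → ENNReal) (f : ℝ → ℝ) (R ρ : ℝ), Measurable v → Measurable w → 0 < R → 0 < ρ → (∀ s, R < s → v s = 0) → (∀ s, R < s → w s = 0) → (∀ s, w s ≤ ENNReal.ofReal (η / R ^ 2)) → (∀ s, 0 ≤ f s ∧ f s ≤ 1) → (∀ s, R ≤ s → f s = 1) → (∀ ε : ℝ, 0 < ε → ∃ K : NNReal, LipschitzOnWith K (fun x : Space => f ‖x‖) {x : Space |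 ε ≤ ‖x‖}) → 2 * scatteringFunctional v (fun x : Space => f ‖x‖) = ∫⁻ x : Space, w ‖x‖ * ENNReal.ofReal (f ‖x‖ ^ 2) → (∀ φ : Space → ℝ, IsScatteringTrial φ → (∀ x : Space, R ≤ ‖x‖ → φ x = 1) → 2 * scatteringFunctional v (fun x : Space => f ‖x‖) + ∫⁻ x : Space, w ‖x‖ * ENNReal.ofReal (φ x ^ 2) ≤ 2 * scatteringFunctional v φ + ∫⁻ x : Space, w ‖x‖ * ENNReal.ofReal (f ‖x‖ ^ 2)) → M ≤ ρ * R ^ 3 → ENNReal.ofReal (ρ * R ^ 2) * (∫⁻ x : Space, w ‖x‖) ≤ ENNReal.ofReal η → ENNReal.ofReal ρ * (∫⁻ x : Space, ENNReal.ofReal (1 - f ‖x‖ ^ 2)) ≤ ENNReal.ofReal ε₀ → ∃ c : ℝ, 0 < c ∧ ∀ᶠ N : ℕ in Filter.atTop, ∃ δ : ENNReal, 0 < δ ∧ ∀ Ψ : PeriodicTrialState N (sideLength ρ N), periodicEnergy v Ψ ≤ periodicGroundStateEnergy v N (sideLength ρ N) + δ → ENNReal.ofReal (c * N) ≤ condensateOccupation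 N (sideLength ρ N) Ψ.ψ) → (∀ v : ℝ → ENNReal, Literature.MathematicalPhysics.QuantumManyBody.BoseGas.IsRepulsiveFiniteRange v → (∃ ρ₀ : ℝ, 0 < ρ₀ ∧ ∀ ρ : ℝ, 0 < ρ → ρ < ρ₀ → ∃ c : ℝ, 0 < c ∧ ∀ᶠ N : ℕ in Filter.atTop, ∃ δ : ENNReal, 0 < δ ∧ ∀ Ψ : Literature.MathematicalPhysics.QuantumManyBody.BoseGas.PeriodicTrialState N (Literature.MathematicalPhysics.QuantumManyBody.BoseGas.sideLength ρ N), Literature.MathematicalPhysics.QuantumManyBody.BoseGas.periodicEnergy v Ψ ≤ Literature.MathematicalPhysics.QuantumManyBody.BoseGas.periodicGroundStateEnergy v N (Literature.MathematicalPhysics.QuantumManyBody.BoseGas.sideLength ρ N) + δ → ENNReal.ofReal (c * N) ≤ Literature.MathematicalPhysics.QuantumManyBody.BoseGas.condensateOccupation N (Literature.MathematicalPhysics.QuantumManyBody.BoseGas.sideLength ρ N) Ψ.ψ) → ∃ ρ₀ : ℝ, 0 < ρ₀ ∧ ∀ ρ : ℝ, 0 < ρ → ρ < ρ₀ → Literature.MathematicalPhysics.QuantumManyBody.BoseGas.HasGroundStateBEC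 v ρ) → Literature.MathematicalPhysics.QuantumManyBody.BoseGas.BoseEinsteinCondensation

end Summit.AtomisticToContinuum.BoseEinsteinCondensation.Theses.BECJastrowKac
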